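import Summits.BirchSwinnertonDyer.BirchSwinnertonDyer.Theorems.ByReductionTypeAtTwoMultTransportNonPrimitiveCountOfPowRealised
import Literature.NumberTheory.EllipticCurves.IsogenySelmerInfty
import HarnessLib

/-!
# T-42 in the kernel, XCV — «F1 ROAD» brick B5 (a): SURJ₂ TRANSFERS ALONG AN ARBITRARY ISOGENY —
# isogeny functoriality of the non-primitive Selmer group `Sel^{Σ₀}_{p^∞}(E/K_∞)` and of the inertia families
# `Y_v = im(H¹(H ∩ D_v, E[p^∞]) → H¹(H ∩ I_v, E[p^∞]))`, and «SURJ(E′) ⟹ SURJ(E)» for every isogeny pair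
# `φ : E → E′`, `ψ : E′ → E` with `ψ ∘ φ = [p^e]` (any number field `K`, any prime `p`)

Cell `bsd-2adic` (run/shared/lean/pub/bsd-2adic/), seat `bsd-2adic-t42` GEN 34 (pen RC-540 SUMMON
`wake/SUMMON-bsd-2adic-t42-20260830T055841Z.md`: brick B5 of road (S-C′) per memo `t42/DESIGN-T42-ADDENDUM-37.md` §A37.5 and
audit-2 D-NOTE B5-CHAIN@2 — «the 2-isogeny transfer SURJ₂(W/⟨P₀⟩) ⟹ SURJ₂(W) TYPED FOR AN ARBITRARY RATIONAL ISOGENY»).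
HONEST FRAMING: research route; THEOREMS ONLY (no `def`, no named fact, no instance, no `sorry`); nothing booked; no door or
class file is touched (k6); BSD is not proved by any of this. PARTITION: X5@2 multiplicative GV-transport rows (K4ᵐ B1·O1; items
19922 / 19923) × p = 2 — reduces-the-named-input-of (the side condition `hB : ¬ TwoTorsionRamifiedAtTwo x` of XCII
`multCongruenceTransportAtTwo_of_printFacts_noF1`); bears_on K4 (`--supports stmt-BirchSwinnertonDyer-19923`).

## What

LXXI re-proved F1's only consumer from SURJ = «the detecting map `c ↦ (res_{H∩I_v}(conj_{γⁿ} c))_{v∈Σ₀, n<N_v} :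
Sel^{Σ₀} → ∏_v ∏_n Y_v` is ONTO»; LXXXV proved SURJ₂ at a multiplicative / good ordinary `2` under the model hypothesis `hmod₁`
(no rational `2`-torsion point in the canonical line `C₂`), which LXXXVI turned into the decidable type-B side condition. Greenberg–Vatsal
(Invent. Math. 142 (2000), p. 28: «The `λ`-invariant is always unchanged by an isogeny») move freely along isogenies; this file is the
kernel form of that move for the surjectivity statement itself, in the tree's inertia currency:

* §1 (any field-level data: `K` a number field, `H ≤ Γ_K`, any `p`, a `Γ_K`-equivariant `f : E(K̄) → E′(K̄)`) the push-forward
  `H¹(id_{H∩I_v}, f) : H¹(H ∩ I_v, E[p^∞]) → H¹(H ∩ I_v, E′[p^∞])` (the tree's `resH1Hom` on the compatible pair) COMMUTES with the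
  restriction `res_{H∩I_v} : H¹(H, ·) → H¹(H ∩ I_v, ·)` (`resH1Hom_inertiaInToH_h1Map`), PRESERVES the local factors `Y_v`
  (`mem_range_resH1Hom_inertiaIn_of_mem_range`), and composes: `H¹(g) ∘ H¹(f) = n` when `g ∘ f = [n]`
  (`resH1Hom_inertiaIn_comp_of_comp_eq_nsmul`) — all from Mathlib's functoriality of continuous cohomology (`resH1Hom_comp`);
* §2 `h1Map_mem_nonPrimitiveSelmerGroupOver` — `H¹(H, f)` maps `Sel^{Σ₀}_E(L)_p` into `Sel^{Σ₀}_{E′}(L)_p` when `f` has local points maps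
  (every `K`-isogeny: `Isogeny.hasLocalPointsMaps_holds`) — the `Σ₀`-twin of the tree's `IsogenySelmerInfty.h1Map_mem_selmerGroupOver`;
* §3 ★ **`surj_of_surj_of_isogeny`** (`K : Type` a number field, cyclotomic `κ`, `Σ₀ ∌ p` finite, any family of lengths `N_v`): for
  isogenies `φ : E → E′`, `ψ : E′ → E` over `K` with `ψ ∘ φ = [p^e]` on `E(K̄)`, SURJ for `E′` ⟹ SURJ for `E` — LXXI's hypothesis `hsurj`
  VERBATIM on both sides. Proof (memo ADDENDUM-35 §A35.7 (2)): push a family `y` of `E`-classes to `φ_* y` (still in `∏∏ Y_v`), realise it by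
  `c′ ∈ Sel^{Σ₀}(E′)`, pull back `c = ψ_* c′ ∈ Sel^{Σ₀}(E)`: it realises `ψ_* φ_* y = p^e · y`; LXXV `surj_of_forall_pow_nsmul_realised`
  (the `p`-divisibility of the `Y_v`, GV Prop. (2.4)) removes the `p^e`. ★ `surj_two_of_surj_of_isogeny` — the `ℚ`, `p = 2`,
  `N_v = 2^{n_v}` instance (the shape consumed by LXXI `natCard_torsionBy_nonPrimitiveSelmerInfty_eq_pow_two_of_surj`).

So SURJ₂ is CONSTANT along every `ℚ`-isogeny whose degree is a power of `2` (apply ★ to `(φ, ψ)` and to `(ψ, φ)`), which is what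
brick B5 needs: an obstructed model (type A, `P₀ ∈ C₂`) inherits SURJ₂ from any `2`-power-isogenous type-B model.

References: [GreenbergVatsal2000] §2 Prop. (2.1), Prop. (2.4), p. 28; [GreenbergLNM1716] §4 Lemma 4.6; [SilvermanAEC2009] III.4, III.6.1–6.2;
[SerreGaloisCohomology1997] I.§2.4; [MilneADT2006] I.§6.
-/

set_option autoImplicit false
set_option linter.dupNamespace false

noncomputable section

open scoped Classical AddSubgroup

universe u

namespace Summit.BirchSwinnertonDyer.BirchSwinnertonDyer.Theorems.NonPrimitiveRestriction

open NumberField IsDedekindDomain Field CategoryTheory WeierstrassCurve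
  Literature.NumberTheory.GaloisRepresentations Literature.NumberTheory.EllipticCurves
  Literature.NumberTheory.EllipticCurves.GreenbergSelmer
  Literature.NumberTheory.EllipticCurves.GreenbergVatsal2000
  Literature.NumberTheory.EllipticCurves.IsogenySelmerInfty
  IsDedekindDomain.HeightOneSpectrum

/-! ## §1. Push-forward of local inertia classes along an equivariant homomorphism -/

section Local

variable {K : Type u} [Field K] [NumberField K] {W W' W'' : WeierstrassCurve K} (p : ℕ)
  (H : Subgroup (absoluteGaloisGroup K)) (v : HeightOneSpectrum (𝓞 K))

/-- The compatibility of the pair `(id_{H ∩ I_v}, f|E[p^∞])` (`H ∩ I_v` acting through `H ∩ I_v ≤ D_v ≤ Γ_K`).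
[cite: SerreGaloisCohomology1997, I.§2.4 (functoriality of H¹ for compatible pairs)] -/
theorem primaryTorsionMap_smul_inertiaIn (f : W.geomPoints →+ W'.geomPoints)
    (hf : ∀ (σ : absoluteGaloisGroup K) (P : W.geomPoints), f (σ • P) = σ • f P)
    (x : inertiaIn H v) (m : geomPrimaryTorsion W p) :
    primaryTorsionMap p f (ContinuousMonoidHom.id (inertiaIn H v) x • m) = x • primaryTorsionMap p f m := by
  change primaryTorsionMap p f ((((x : decomp (K := K) v) : absoluteGaloisGroup K)) • m) =
    ((x : decomp (K := K) v) : absoluteGaloisGroup K) • primaryTorsionMap p f m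
  exact primaryTorsionMap_smul p f hf _ m

/-- The compatibility of the pair `(id_{H ∩ D_v}, f|E[p^∞])`. [cite: SerreGaloisCohomology1997, I.§2.4 (functoriality of H¹ for compatible pairs)] -/
theorem primaryTorsionMap_smul_decompIn (f : W.geomPoints →+ W'.geomPoints)
    (hf : ∀ (σ : absoluteGaloisGroup K) (P : W.geomPoints), f (σ • P) = σ • f P)
    (x : decompIn H v) (m : geomPrimaryTorsion W p) :
    primaryTorsionMap p f (ContinuousMonoidHom.id (decompIn H v) x • m) = x • primaryTorsionMap p f m := by
  change primaryTorsionMap p f ((((x : decomp (K := K) v) : absoluteGaloisGroup K)) • m) =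
    ((x : decomp (K := K) v) : absoluteGaloisGroup K) • primaryTorsionMap p f m
  exact primaryTorsionMap_smul p f hf _ m

/-- **`H¹(id_{H∩I_v}, f)` commutes with the restriction `H¹(H, ·) → H¹(H ∩ I_v, ·)`**: both composites are induced by the compatible
pair `(H ∩ I_v → H, f|E[p^∞])` (`resH1Hom_comp`). [cite: SerreGaloisCohomology1997, I.§2.4 (functoriality of H¹ for compatible pairs)] -/
theorem resH1Hom_inertiaInToH_h1Map (f : W.geomPoints →+ W'.geomPoints)
    (hf : ∀ (σ : absoluteGaloisGroup K) (P : W.geomPoints), f (σ • P) = σ • f P) (c : W.subgroupH1 p H) :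
    resH1Hom (inertiaInToH H v) (AddMonoidHom.id (geomPrimaryTorsion W' p)) (fun _ _ ↦ rfl) (h1Map p H f hf c) =
      resH1Hom (ContinuousMonoidHom.id (inertiaIn H v)) (primaryTorsionMap p f) (primaryTorsionMap_smul_inertiaIn p H v f hf)
        (resH1Hom (inertiaInToH H v) (AddMonoidHom.id (geomPrimaryTorsion W p)) (fun _ _ ↦ rfl) c) := by
  have h₁ := congrArg (fun F ↦ F c) (resH1Hom_comp (ContinuousMonoidHom.id H) (primaryTorsionMap p f)
    (primaryTorsionMap_smul_subgroup p H f hf) (inertiaInToH H v) (AddMonoidHom.id (geomPrimaryTorsion W' p)) (fun _ _ ↦ rfl))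
  have h₂ := congrArg (fun F ↦ F c) (resH1Hom_comp (inertiaInToH H v) (AddMonoidHom.id (geomPrimaryTorsion W p)) (fun _ _ ↦ rfl)
    (ContinuousMonoidHom.id (inertiaIn H v)) (primaryTorsionMap p f) (primaryTorsionMap_smul_inertiaIn p H v f hf))
  simp only [AddMonoidHom.coe_comp, Function.comp_apply] at h₁ h₂
  unfold h1Map
  rw [h₁, h₂]
  exact DFunLike.congr_fun (resH1Hom_congr (by ext; rfl) (by ext; rfl) _ _) c

/-- **`H¹(id, f)` maps the local factor `Y_v(E) = im(H¹(H ∩ D_v, E[p^∞]) → H¹(H ∩ I_v, E[p^∞]))` into `Y_v(E′)`**: the push-forward of a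
restricted class is the restriction of the pushed-forward class (`resH1Hom_comp` on `H ∩ I_v ≤ H ∩ D_v`).
[cite: GreenbergVatsal2000, §2 p. 17 (the groups H¹((ℚ_∞)_η, A) → H¹(I_η, A))] [cite: SerreGaloisCohomology1997, I.§2.4] -/
theorem mem_range_resH1Hom_inertiaIn_of_mem_range (f : W.geomPoints →+ W'.geomPoints)
    (hf : ∀ (σ : absoluteGaloisGroup K) (P : W.geomPoints), f (σ • P) = σ • f P)
    {y : discreteH1 (inertiaIn H v) (geomPrimaryTorsion W p)}
    (hy : y ∈ (resH1Hom (subgroupInclusion (inertiaIn_le_decompIn H v)) (AddMonoidHom.id (geomPrimaryTorsion W p))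
      (fun _ _ ↦ rfl)).range) :
    resH1Hom (ContinuousMonoidHom.id (inertiaIn H v)) (primaryTorsionMap p f) (primaryTorsionMap_smul_inertiaIn p H v f hf) y ∈
      (resH1Hom (subgroupInclusion (inertiaIn_le_decompIn H v)) (AddMonoidHom.id (geomPrimaryTorsion W' p))
        (fun _ _ ↦ rfl)).range := by
  obtain ⟨z, rfl⟩ := hy
  refine ⟨resH1Hom (ContinuousMonoidHom.id (decompIn H v)) (primaryTorsionMap p f) (primaryTorsionMap_smul_decompIn p H v f hf) z, ?_⟩
  have h₁ := congrArg (fun F ↦ F z) (resH1Hom_comp (ContinuousMonoidHom.id (decompIn H v)) (primaryTorsionMap p f)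
    (primaryTorsionMap_smul_decompIn p H v f hf) (subgroupInclusion (inertiaIn_le_decompIn H v))
    (AddMonoidHom.id (geomPrimaryTorsion W' p)) (fun _ _ ↦ rfl))
  have h₂ := congrArg (fun F ↦ F z) (resH1Hom_comp (subgroupInclusion (inertiaIn_le_decompIn H v))
    (AddMonoidHom.id (geomPrimaryTorsion W p)) (fun _ _ ↦ rfl)
    (ContinuousMonoidHom.id (inertiaIn H v)) (primaryTorsionMap p f) (primaryTorsionMap_smul_inertiaIn p H v f hf))
  simp only [AddMonoidHom.coe_comp, Function.comp_apply] at h₁ h₂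
  rw [h₁, h₂]
  exact DFunLike.congr_fun (resH1Hom_congr (by ext; rfl) (by ext; rfl) _ _) z

/-- **`H¹(id, g) ∘ H¹(id, f) = n`** on `H¹(H ∩ I_v, E[p^∞])` when `g ∘ f = [n]` on `E(K̄)` (explicit cocycles: `[a] ↦ [g ∘ f ∘ a] = [n·a]`).
[cite: SilvermanAEC2009, Thm. III.6.2(a) (φ̂ ∘ φ = [m])] [cite: SerreGaloisCohomology1997, I.§2.4] -/
theorem resH1Hom_inertiaIn_comp_of_comp_eq_nsmul (f : W.geomPoints →+ W'.geomPoints)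
    (hf : ∀ (σ : absoluteGaloisGroup K) (P : W.geomPoints), f (σ • P) = σ • f P)
    (g : W'.geomPoints →+ W.geomPoints)
    (hg : ∀ (σ : absoluteGaloisGroup K) (Q : W'.geomPoints), g (σ • Q) = σ • g Q)
    {n : ℕ} (h : ∀ P : W.geomPoints, g (f P) = (n : ℤ) • P) (y : discreteH1 (inertiaIn H v) (geomPrimaryTorsion W p)) :
    resH1Hom (ContinuousMonoidHom.id (inertiaIn H v)) (primaryTorsionMap p g) (primaryTorsionMap_smul_inertiaIn p H v g hg)
      (resH1Hom (ContinuousMonoidHom.id (inertiaIn H v)) (primaryTorsionMap p f) (primaryTorsionMap_smul_inertiaIn p H v f hf) y) =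
      n • y := by
  obtain ⟨a, rfl⟩ := oneCocycleClass_surjective _ y
  rw [resH1Hom_id_oneCocycleClass, resH1Hom_id_oneCocycleClass]
  have hs := oneCocycleClass_smul (discreteTopRep (inertiaIn H v) (geomPrimaryTorsion W p)) (n : ℤ) a
  conv at hs => rhs; rw [Nat.cast_smul_eq_nsmul]
  rw [← hs]
  congr 1
  apply Subtype.ext
  ext σ
  change g (f ((a.1 σ : geomPrimaryTorsion W p) : W.geomPoints)) =
    (((n : ℤ) • a.1 σ : geomPrimaryTorsion W p) : W.geomPoints)
  rw [h, AddSubgroupClass.coe_zsmul]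

end Local

/-! ## §2. `H¹(H, f)` maps `Sel^{Σ₀}_E(L)_p` into `Sel^{Σ₀}_{E′}(L)_p` -/

section NonPrimitive

variable {K : Type u} [Field K] [NumberField K] {W W' : WeierstrassCurve K} (p : ℕ)
  (H : Subgroup (absoluteGaloisGroup K)) [H.Normal] (S₀ : Set (HeightOneSpectrum (𝓞 K)))

/-- **`H¹(H, f)` maps the non-primitive Selmer group `Sel^{Σ₀}_E(L)_p` into `Sel^{Σ₀}_{E′}(L)_p`** (`L = K̄^H`) when `f` has local
points maps (every `K`-isogeny): the local condition at every place NOT above `Σ₀` and every conjugate is respected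
(`h1Map_mem_localKerOver`, `h1Map_conjH1`) — the `Σ₀`-twin of `IsogenySelmerInfty.h1Map_mem_selmerGroupOver`.
[cite: GreenbergVatsal2000, §1 p. 7 (definition of Sel^{Σ₀}) and §2 p. 28 (isogenies)] [cite: MilneADT2006, I.§6 (Selmer groups; functoriality)] -/
theorem h1Map_mem_nonPrimitiveSelmerGroupOver (f : W.geomPoints →+ W'.geomPoints)
    (hf : ∀ (σ : absoluteGaloisGroup K) (P : W.geomPoints), f (σ • P) = σ • f P)
    (hloc : HasLocalPointsMaps W W' f) {c : W.subgroupH1 p H} (hc : c ∈ nonPrimitiveSelmerGroupOver W p H S₀) :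
    h1Map p H f hf c ∈ nonPrimitiveSelmerGroupOver W' p H S₀ := by
  rw [mem_nonPrimitiveSelmerGroupOver_iff] at hc ⊢
  refine ⟨fun v hv σ ↦ ?_, fun w σ ↦ ?_⟩
  · obtain ⟨fE, hfE, hcomp⟩ := hloc (v.adicCompletion K)
    rw [← h1Map_conjH1]
    exact h1Map_mem_localKerOver p H f hf fE hfE hcomp (hc.1 v hv σ)
  · obtain ⟨fE, hfE, hcomp⟩ := hloc w.Completion
    rw [← h1Map_conjH1]
    exact h1Map_mem_localKerOver p H f hf fE hfE hcomp (hc.2 w σ)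

/-- **`Sel(φ)` maps `Sel^{Σ₀}_{p^∞}(E/K_∞)` into `Sel^{Σ₀}_{p^∞}(E′/K_∞)` for a `K`-isogeny `φ : E → E′`** (local points maps by
`Isogeny.hasLocalPointsMaps_holds`). [cite: GreenbergVatsal2000, §2 p. 28 (a p-isogeny)] [cite: MilneADT2006, I.§6 (Selmer groups; functoriality)] -/
theorem h1Map_isogeny_mem_nonPrimitiveSelmerInfty [Fact p.Prime] (κ : ZpExtension K p) (φ : Isogeny W W')
    {c : W.subgroupH1 p κ.kerSubgroup} (hc : c ∈ nonPrimitiveSelmerInfty W κ S₀) :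
    h1Map p κ.kerSubgroup φ.toAddMonoidHom φ.equivariant c ∈ nonPrimitiveSelmerInfty W' κ S₀ := by
  haveI : PerfectField K := PerfectField.ofCharZero
  haveI : κ.kerSubgroup.Normal := by rw [ZpExtension.kerSubgroup]; infer_instance
  exact h1Map_mem_nonPrimitiveSelmerGroupOver p κ.kerSubgroup S₀ φ.toAddMonoidHom φ.equivariant
    (Isogeny.hasLocalPointsMaps_holds W W' φ) hc

end NonPrimitive

/-! ## §3. ★ SURJ transfers along an isogeny pair `ψ ∘ φ = [p^e]` -/

section Transfer

-- `K : Type` (universe `0`): LXXV `surj_of_forall_pow_nsmul_realised` (the signed lane's `localFactor_divisible`) is stated for `K : Type`.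
variable {K : Type} [Field K] [NumberField K] (W : WeierstrassCurve K) [W.IsElliptic] (W' : WeierstrassCurve K)
  {p : ℕ} [hp : Fact p.Prime] (κ : ZpExtension K p) {γ : absoluteGaloisGroup K}

omit [W.IsElliptic] in
/-- **Realisation of `p^e · y` pulled back along an isogeny pair.** For isogenies `φ : E → E′`, `ψ : E′ → E` over `K` with
`ψ ∘ φ = [n]` on `E(K̄)` and a finite `Σ₀ = S₀`: if every family `y′ ∈ ∏_{v∈S₀} ∏_{i<N_v} Y_v(E′)` is
`(res_{H∩I_v}(conj_{γⁱ} c′))` for some `c′ ∈ Sel^{Σ₀}(E′/K_∞)`, then for every family `y ∈ ∏∏ Y_v(E)` the family `n · y` is so realised by a class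
of `Sel^{Σ₀}(E/K_∞)` — namely by `ψ_* c′` where `c′` realises `φ_* y` (§1–§2). [cite: GreenbergVatsal2000, §2 Prop. (2.1) and p. 28]
[cite: SilvermanAEC2009, Thm. III.6.2(a)] -/
theorem forall_nsmul_realised_of_surj_of_isogeny (S₀ : Finset (HeightOneSpectrum (𝓞 K)))
    (N : HeightOneSpectrum (𝓞 K) → ℕ) (φ : Isogeny W W') (ψ : Isogeny W' W) {n : ℕ}
    (hψφ : ∀ P : W.geomPoints, ψ (φ P) = (n : ℤ) • P)
    (hsurj' : ∀ y' : (Π i : ↥S₀, Fin (N i.1) → discreteH1 (inertiaIn κ.kerSubgroup i.1) (W'.geomPrimaryTorsion p)),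
      (∀ (i : ↥S₀) (k : Fin (N i.1)), y' i k ∈
        (resH1Hom (subgroupInclusion (inertiaIn_le_decompIn κ.kerSubgroup i.1)) (AddMonoidHom.id (W'.geomPrimaryTorsion p))
          (fun _ _ ↦ rfl)).range) →
      ∃ c' ∈ nonPrimitiveSelmerInfty W' κ (↑S₀ : Set (HeightOneSpectrum (𝓞 K))),
        ∀ (i : ↥S₀) (k : Fin (N i.1)),
          resH1Hom (inertiaInToH κ.kerSubgroup i.1) (AddMonoidHom.id (W'.geomPrimaryTorsion p)) (fun _ _ ↦ rfl)
            (conjH1 κ.kerSubgroup (W'.geomPrimaryTorsion p) (γ ^ (k : ℕ)) c') = y' i k)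
    (y : Π i : ↥S₀, Fin (N i.1) → discreteH1 (inertiaIn κ.kerSubgroup i.1) (W.geomPrimaryTorsion p))
    (hy : ∀ (i : ↥S₀) (k : Fin (N i.1)), y i k ∈
      (resH1Hom (subgroupInclusion (inertiaIn_le_decompIn κ.kerSubgroup i.1)) (AddMonoidHom.id (W.geomPrimaryTorsion p))
        (fun _ _ ↦ rfl)).range) :
    ∃ c ∈ nonPrimitiveSelmerInfty W κ (↑S₀ : Set (HeightOneSpectrum (𝓞 K))),
      ∀ (i : ↥S₀) (k : Fin (N i.1)),
        resH1Hom (inertiaInToH κ.kerSubgroup i.1) (AddMonoidHom.id (W.geomPrimaryTorsion p)) (fun _ _ ↦ rfl)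
          (conjH1 κ.kerSubgroup (W.geomPrimaryTorsion p) (γ ^ (k : ℕ)) c) = n • y i k := by
  haveI : κ.kerSubgroup.Normal := by rw [ZpExtension.kerSubgroup]; infer_instance
  -- push the family forward along `φ`
  let y' : Π i : ↥S₀, Fin (N i.1) → discreteH1 (inertiaIn κ.kerSubgroup i.1) (W'.geomPrimaryTorsion p) := fun i k ↦
    resH1Hom (ContinuousMonoidHom.id (inertiaIn κ.kerSubgroup i.1)) (primaryTorsionMap p φ.toAddMonoidHom)
      (primaryTorsionMap_smul_inertiaIn p κ.kerSubgroup i.1 φ.toAddMonoidHom φ.equivariant) (y i k)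
  have hy' : ∀ (i : ↥S₀) (k : Fin (N i.1)), y' i k ∈
      (resH1Hom (subgroupInclusion (inertiaIn_le_decompIn κ.kerSubgroup i.1)) (AddMonoidHom.id (W'.geomPrimaryTorsion p))
        (fun _ _ ↦ rfl)).range := fun i k ↦
    mem_range_resH1Hom_inertiaIn_of_mem_range p κ.kerSubgroup i.1 φ.toAddMonoidHom φ.equivariant (hy i k)
  -- realise it on `E′` and pull back along `ψ`
  obtain ⟨c', hc', hreal⟩ := hsurj' y' hy'
  refine ⟨h1Map p κ.kerSubgroup ψ.toAddMonoidHom ψ.equivariant c', h1Map_isogeny_mem_nonPrimitiveSelmerInfty p _ κ ψ hc', fun i k ↦ ?_⟩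
  have hconj : conjH1 κ.kerSubgroup (W.geomPrimaryTorsion p) (γ ^ (k : ℕ)) (h1Map p κ.kerSubgroup ψ.toAddMonoidHom ψ.equivariant c') =
      h1Map p κ.kerSubgroup ψ.toAddMonoidHom ψ.equivariant (conjH1 κ.kerSubgroup (W'.geomPrimaryTorsion p) (γ ^ (k : ℕ)) c') :=
    (h1Map_conjH1 p κ.kerSubgroup ψ.toAddMonoidHom ψ.equivariant (γ ^ (k : ℕ)) c').symm
  rw [hconj, resH1Hom_inertiaInToH_h1Map p κ.kerSubgroup i.1 ψ.toAddMonoidHom ψ.equivariant, hreal i k]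
  exact resH1Hom_inertiaIn_comp_of_comp_eq_nsmul p κ.kerSubgroup i.1 φ.toAddMonoidHom φ.equivariant ψ.toAddMonoidHom ψ.equivariant
    (fun P ↦ hψφ P) (y i k)

/-- ★ **SURJ TRANSFERS ALONG AN ISOGENY PAIR `ψ ∘ φ = [p^e]`** (brick B5 (a), KERNEL, any number field `K`, any `p`, cyclotomic `κ`,
`Σ₀ ∌ p` finite, any lengths `N_v`): for `K`-isogenies `φ : E → E′`, `ψ : E′ → E` with `ψ ∘ φ = [p^e]` on `E(K̄)`, if the detecting map of
`E′` is onto `∏_{v∈Σ₀} ∏_{i<N_v} Y_v(E′)` (LXXI's `hsurj` for `E′`), then the detecting map of `E` is onto `∏∏ Y_v(E)` (LXXI's `hsurj` for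
`E`, VERBATIM): `p^e · y` is realised by `ψ_*` of a realisation of `φ_* y` (`forall_nsmul_realised_of_surj_of_isogeny`), and the `Y_v` are
`p`-divisible (LXXV `surj_of_forall_pow_nsmul_realised`, GV Prop. (2.4)). [cite: GreenbergVatsal2000, §2 Prop. (2.1), Prop. (2.4) and p. 28]
[cite: SilvermanAEC2009, Thm. III.6.1(a), III.6.2(a)] -/
theorem surj_of_surj_of_isogeny (hκ : κ.IsCyclotomic) (S₀ : Finset (HeightOneSpectrum (𝓞 K)))
    (hS₀ : ∀ v ∈ S₀, ((p : ℕ) : 𝓞 K) ∉ v.asIdeal) (N : HeightOneSpectrum (𝓞 K) → ℕ)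
    (φ : Isogeny W W') (ψ : Isogeny W' W) (e : ℕ) (hψφ : ∀ P : W.geomPoints, ψ (φ P) = ((p ^ e : ℕ) : ℤ) • P)
    (hsurj' : ∀ y' : (Π i : ↥S₀, Fin (N i.1) → discreteH1 (inertiaIn κ.kerSubgroup i.1) (W'.geomPrimaryTorsion p)),
      (∀ (i : ↥S₀) (k : Fin (N i.1)), y' i k ∈
        (resH1Hom (subgroupInclusion (inertiaIn_le_decompIn κ.kerSubgroup i.1)) (AddMonoidHom.id (W'.geomPrimaryTorsion p))
          (fun _ _ ↦ rfl)).range) →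
      ∃ c' ∈ nonPrimitiveSelmerInfty W' κ (↑S₀ : Set (HeightOneSpectrum (𝓞 K))),
        ∀ (i : ↥S₀) (k : Fin (N i.1)),
          resH1Hom (inertiaInToH κ.kerSubgroup i.1) (AddMonoidHom.id (W'.geomPrimaryTorsion p)) (fun _ _ ↦ rfl)
            (conjH1 κ.kerSubgroup (W'.geomPrimaryTorsion p) (γ ^ (k : ℕ)) c') = y' i k) :
    ∀ y : (Π i : ↥S₀, Fin (N i.1) → discreteH1 (inertiaIn κ.kerSubgroup i.1) (W.geomPrimaryTorsion p)),
      (∀ (i : ↥S₀) (k : Fin (N i.1)), y i k ∈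
        (resH1Hom (subgroupInclusion (inertiaIn_le_decompIn κ.kerSubgroup i.1)) (AddMonoidHom.id (W.geomPrimaryTorsion p))
          (fun _ _ ↦ rfl)).range) →
      ∃ c ∈ nonPrimitiveSelmerInfty W κ (↑S₀ : Set (HeightOneSpectrum (𝓞 K))),
        ∀ (i : ↥S₀) (k : Fin (N i.1)),
          resH1Hom (inertiaInToH κ.kerSubgroup i.1) (AddMonoidHom.id (W.geomPrimaryTorsion p)) (fun _ _ ↦ rfl)
            (conjH1 κ.kerSubgroup (W.geomPrimaryTorsion p) (γ ^ (k : ℕ)) c) = y i k :=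
  surj_of_forall_pow_nsmul_realised W κ hκ S₀ hS₀ N e
    (forall_nsmul_realised_of_surj_of_isogeny W W' κ S₀ N φ ψ hψφ hsurj')

/-- ★ **SURJ₂ TRANSFERS ALONG A `ℚ`-ISOGENY PAIR `ψ ∘ φ = [2^e]`** — the `ℚ`, `p = 2`, `N_v = 2^{n_v}` instance of
`surj_of_surj_of_isogeny` (the shape consumed by LXXI `natCard_torsionBy_nonPrimitiveSelmerInfty_eq_pow_two_of_surj` and produced by LXXXV
`surj_nonPrimitive_{mult,ord}_two`): SURJ₂ for `W′` ⟹ SURJ₂ for `W`. With `(φ, ψ)` and `(ψ, φ)` both admissible (`φ ∘ ψ = [2^e]` too, AEC III.6.2),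
SURJ₂ is constant on `2`-power `ℚ`-isogeny classes. [cite: GreenbergVatsal2000, §2 Prop. (2.1) and p. 28] [cite: SilvermanAEC2009, Thm. III.6.2(a)] -/
theorem surj_two_of_surj_of_isogeny (W : WeierstrassCurve ℚ) [W.IsElliptic] (W' : WeierstrassCurve ℚ) {κ : ZpExtension ℚ 2}
    {γ : absoluteGaloisGroup ℚ} (hκ : κ.IsCyclotomic) (S₀ : Finset (HeightOneSpectrum (𝓞 ℚ)))
    (hS₀ : ∀ v ∈ S₀, ((2 : ℕ) : 𝓞 ℚ) ∉ v.asIdeal)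
    (φ : Isogeny W W') (ψ : Isogeny W' W) (e : ℕ) (hψφ : ∀ P : W.geomPoints, ψ (φ P) = ((2 ^ e : ℕ) : ℤ) • P)
    (hsurj' : ∀ y' : (Π i : ↥S₀, Fin (2 ^ padicValNat 2 ((Rat.HeightOneSpectrum.natGenerator i.1 ^ 2 - 1) / 8)) →
        discreteH1 (inertiaIn κ.kerSubgroup i.1) (W'.geomPrimaryTorsion 2)),
      (∀ (i : ↥S₀) (k : Fin (2 ^ padicValNat 2 ((Rat.HeightOneSpectrum.natGenerator i.1 ^ 2 - 1) / 8))), y' i k ∈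
        (resH1Hom (subgroupInclusion (inertiaIn_le_decompIn κ.kerSubgroup i.1)) (AddMonoidHom.id (W'.geomPrimaryTorsion 2))
          (fun _ _ ↦ rfl)).range) →
      ∃ c' ∈ nonPrimitiveSelmerInfty W' κ (↑S₀ : Set (HeightOneSpectrum (𝓞 ℚ))),
        ∀ (i : ↥S₀) (k : Fin (2 ^ padicValNat 2 ((Rat.HeightOneSpectrum.natGenerator i.1 ^ 2 - 1) / 8))),
          resH1Hom (inertiaInToH κ.kerSubgroup i.1) (AddMonoidHom.id (W'.geomPrimaryTorsion 2)) (fun _ _ ↦ rfl)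
            (conjH1 κ.kerSubgroup (W'.geomPrimaryTorsion 2) (γ ^ (k : ℕ)) c') = y' i k) :
    ∀ y : (Π i : ↥S₀, Fin (2 ^ padicValNat 2 ((Rat.HeightOneSpectrum.natGenerator i.1 ^ 2 - 1) / 8)) →
        discreteH1 (inertiaIn κ.kerSubgroup i.1) (W.geomPrimaryTorsion 2)),
      (∀ (i : ↥S₀) (k : Fin (2 ^ padicValNat 2 ((Rat.HeightOneSpectrum.natGenerator i.1 ^ 2 - 1) / 8))), y i k ∈
        (resH1Hom (subgroupInclusion (inertiaIn_le_decompIn κ.kerSubgroup i.1)) (AddMonoidHom.id (W.geomPrimaryTorsion 2))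
          (fun _ _ ↦ rfl)).range) →
      ∃ c ∈ nonPrimitiveSelmerInfty W κ (↑S₀ : Set (HeightOneSpectrum (𝓞 ℚ))),
        ∀ (i : ↥S₀) (k : Fin (2 ^ padicValNat 2 ((Rat.HeightOneSpectrum.natGenerator i.1 ^ 2 - 1) / 8))),
          resH1Hom (inertiaInToH κ.kerSubgroup i.1) (AddMonoidHom.id (W.geomPrimaryTorsion 2)) (fun _ _ ↦ rfl)
            (conjH1 κ.kerSubgroup (W.geomPrimaryTorsion 2) (γ ^ (k : ℕ)) c) = y i k :=
  haveI : Fact (Nat.Prime 2) := ⟨Nat.prime_two⟩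
  surj_of_surj_of_isogeny W W' κ hκ S₀ hS₀
    (fun v ↦ 2 ^ padicValNat 2 ((Rat.HeightOneSpectrum.natGenerator v ^ 2 - 1) / 8)) φ ψ e hψφ hsurj'

end Transfer

end Summit.BirchSwinnertonDyer.BirchSwinnertonDyer.Theorems.NonPrimitiveRestriction

end
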